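import Literature.Topology.FourManifolds.SlideContext
import Literature.Topology.FourManifolds.LeftHandDiscArcLevels
import HarnessLib

/-!
# The feet and the axis of the slide context lie on the left-hand disc

Topic `Literature/Topology/FourManifolds` (fact seat
`provefact-Literature.Topology.FourManifolds.lauden-f709dd520c`, Laudenbach–Poénaru's Lemma 2: the
loop `x_q` through the `1`-handle of `q` is defined with the left-hand disc of the gradient-like
field `ξ` (Milnor's setting `Cobordism.LeftSphereSetting` for the nice Morse function `g`),
while the slide is performed with the handle-extension data of a slide context
(`SlideContext.lean`) for the rearranged function `g_q = g + d` near `q`, whose chart has the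
coordinates of the Milnor box of the setting; this file identifies the two pictures).
Everything here is **proved**; no named facts.

For a setting `L` (critical point `q`, box of size `ε_L`, index `1`) and a slide context `C`
on the same manifold with `C.S.p = q`, whose handle chart has the coordinates of `L.box.chart`
on its domain, which contains the chart points of norm `≤ ε` (`ε = C.S.ε`, `ε² ≤ 2 ε_L²`), and
with `C.S.f = g + d` on that domain:

* `axisVec s` — the parameter `(s √m / ε_L) e₀ ∈ ℝ¹` (`m = ε²/2` the depth of the feet), of norm
  `√m/ε_L ≤ 1` for `s = ±1`; `foot_eq_discPoint` — **the centre of the foot of sign `s` of the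
  slide context is the point `L.discPoint (axisVec s)` of the top disc of the setting**, hence a
  point of the left-hand disc `leftHandDisc g ξ q L.b` (`foot_mem_leftHandDisc`);
* `discPoint_mem_N` — the points `L.discPoint v`, `‖v‖ ≤ √m/ε_L` (the axis segment between the
  two feet) lie in the handle region `C.S.N`, at levels `C.S.f ∈ [a, f p]`;
* `mem_image_discPoint_of_le` — a point of the left-hand disc with `a ≤ C.S.f` is such a point.

## References

* J. Milnor, *Lectures on the h-cobordism theorem* (1965), Def. 3.1, Def. 3.9, proof of
  Thm. 3.13 (PDF pp. 12, 16, 18). [MilnorHCobordism1965]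
-/

open scoped Manifold ContDiff Topology
open Set Function Filter Metric Module

noncomputable section

namespace Literature.Topology.FourManifolds

open BoundaryManifold

universe u

variable {n : ℕ} {M₀ N₀ : Type u} [TopologicalSpace M₀] [ChartedSpace (EuclideanSpace ℝ (Fin n)) M₀]
  [TopologicalSpace N₀] [ChartedSpace (EuclideanSpace ℝ (Fin n)) N₀]

namespace Cobordism.LeftSphereSetting

variable {c : Cobordism n M₀ N₀} {g : c.W → ℝ} {ξ : Π x : c.W, TangentSpace (𝓡∂ (n + 1)) x}
  (L : LeftSphereSetting c g ξ 0) (C : SlideContext n c.W)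

/-- **Compatibility of a slide context with a left-sphere setting**: same critical point, the
handle chart has the coordinates of the box chart on its domain, which contains the chart points
of norm `≤ ε`, the scales satisfy `ε² ≤ 2 ε_L²`, and `C.S.f = g + d` on the domain of the handle
chart. [cite: MilnorHCobordism1965, Def. 3.1 and proof of Thm. 3.13] -/
structure Compat : Prop where
  hp : C.S.p = L.q
  coord : ∀ x ∈ C.S.D.chart.source, C.S.D.chart.extend (𝓡∂ (n + 1)) x = L.box.chart.extend (𝓡∂ (n + 1)) x
  source_subset : C.S.D.chart.source ⊆ L.box.chart.source
  chartPoint_mem : ∀ w : EuclideanSpace ℝ (Fin (n + 1)), ‖w‖ ≤ C.S.ε → L.chartPoint w ∈ C.S.D.chart.source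
  scale : C.S.ε ^ 2 ≤ 2 * L.ε ^ 2
  shift : ∃ d : ℝ, ∀ x ∈ C.S.D.chart.source, C.S.f x = g x + d

namespace Compat

variable {L C}

/-- The depth `m = ε²/2` of the feet is at most `ε_L²`. [folklore] -/
theorem m_le (h : Compat L C) : C.toCtx.m ≤ L.ε ^ 2 := by rw [C.toCtx.m_eq]; have := h.scale; simp only [SlideContext.toCtx_S] at *; linarith

/-- `√m ≤ ε_L`. [folklore] -/
theorem sqrt_m_le (h : Compat L C) : √C.toCtx.m ≤ L.ε :=
  (Real.sqrt_le_sqrt h.m_le).trans (by rw [Real.sqrt_sq L.eps_pos.le])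

/-- `√m ≤ ε`. [folklore] -/
theorem sqrt_m_le_ε (C : SlideContext n c.W) : √C.toCtx.m ≤ C.S.ε := by
  rw [C.toCtx.m_eq, Real.sqrt_le_left (by exact C.S.ε_pos.le)]
  show C.S.ε ^ 2 / 2 ≤ C.S.ε ^ 2; linarith [sq_nonneg C.S.ε]

/-- **The axis parameter** of the foot of sign `s`: `(s √m / ε_L) e₀ ∈ ℝ¹`. [folklore] -/
def axisVec (L : LeftSphereSetting c g ξ 0) (C : SlideContext n c.W) (s : ℝ) : EuclideanSpace ℝ (Fin 1) :=
  (s * √C.toCtx.m / L.ε) • EuclideanSpace.single 0 1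

/-- Its norm is `√m/ε_L` for `s = ±1`. [folklore] -/
theorem norm_axisVec (L : LeftSphereSetting c g ξ 0) (C : SlideContext n c.W) {s : ℝ} (hs : s ^ 2 = 1) :
    ‖axisVec L C s‖ = √C.toCtx.m / L.ε := by
  have hs' : |s| = 1 := by
    have : |s| ^ 2 = 1 := by rw [sq_abs, hs]
    nlinarith [abs_nonneg s]
  have h1 : ‖EuclideanSpace.single (0 : Fin 1) (1 : ℝ)‖ = 1 := by simp
  rw [axisVec, norm_smul, h1, mul_one, Real.norm_eq_abs, abs_div, abs_mul, hs',
    one_mul, abs_of_nonneg (Real.sqrt_nonneg _), abs_of_pos L.eps_pos]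

/-- Its norm is `≤ 1`. [folklore] -/
theorem norm_axisVec_le (h : Compat L C) {s : ℝ} (hs : s ^ 2 = 1) : ‖axisVec L C s‖ ≤ 1 := by
  rw [norm_axisVec L C hs, div_le_one L.eps_pos]; exact h.sqrt_m_le

/-- **The foot vector in the box coordinates**: `footModel n s m ρ 0 = (ε_L · axisVec s, 0)`. [folklore] -/
theorem footModel_zero_eq_lowerEmb (L : LeftSphereSetting c g ξ 0) (C : SlideContext n c.W) (s : ℝ) :
    footModel n s C.toCtx.m C.toCtx.ρ 0 = lowerEmb 1 (n + 1) (L.ε • axisVec L C s) := by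
  have h0 : footRadial n C.toCtx.ρ (0 : EuclideanSpace ℝ (Fin n)) = 0 := by
    have := norm_univUnitBall (0 : EuclideanSpace ℝ (Fin n))
    rw [norm_zero, zero_div] at this
    rw [footRadial, norm_eq_zero.1 this, smul_zero]
  ext i
  rw [lowerEmb_apply]
  refine Fin.cases ?_ (fun j => ?_) i
  · rw [footModel_apply_zero, h0, norm_zero]
    have hε := L.eps_pos.ne'
    simp [axisVec]
    field_simp
  · have : ¬ ((j.succ : ℕ) < 1) := by simp
    rw [dif_neg this]
    show (consCLE n (footRadial n C.toCtx.ρ 0, s * √(C.toCtx.m + ‖footRadial n C.toCtx.ρ (0 : EuclideanSpace ℝ (Fin n))‖ ^ 2))) j.succ = 0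
    rw [consCLE_apply_succ, h0]; rfl

/-- **The centre of the foot of sign `s` is the point `discPoint (axisVec s)` of the top disc.**
[cite: MilnorHCobordism1965, Def. 3.9 (PDF p. 16), proof of Thm. 3.13 (PDF p. 18)] -/
theorem foot_eq_discPoint (h : Compat L C) {s : ℝ} (hs : s ^ 2 = 1) : C.S.D.foot s C.toCtx.m C.toCtx.ρ 0 = L.discPoint (axisVec L C s) := by
  -- the right-hand side lies in the domain of the handle chart, with the foot coordinates
  have hw : ‖lowerEmb 1 (n + 1) (L.ε • axisVec L C s)‖ ≤ C.S.ε := by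
    rw [L.norm_lowerEmb_smul, norm_axisVec L C hs, mul_div_cancel₀ _ L.eps_pos.ne']; exact sqrt_m_le_ε C
  have hmem : L.discPoint (axisVec L C s) ∈ C.S.D.chart.source := h.chartPoint_mem _ hw
  have hw3 : ‖lowerEmb 1 (n + 1) (L.ε • axisVec L C s)‖ ≤ 3 * L.ε := by
    rw [L.norm_lowerEmb_smul, norm_axisVec L C hs, mul_div_cancel₀ _ L.eps_pos.ne']; linarith [h.sqrt_m_le, L.eps_pos]
  -- read the handle chart at that point
  set w := lowerEmb 1 (n + 1) (L.ε • axisVec L C s) with hwdef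
  have hy : L.box.chart.extend (𝓡∂ (n + 1)) (L.discPoint (axisVec L C s)) =
      L.box.chart.extend (𝓡∂ (n + 1)) L.q + w :=
    (L.box.chart.extend (𝓡∂ (n + 1))).right_inv (L.box.add_mem_target_of_norm_le hw3)
  have hp : C.S.D.chart.extend (𝓡∂ (n + 1)) C.S.p = L.box.chart.extend (𝓡∂ (n + 1)) L.q := by
    rw [h.coord _ C.S.D.mem_source, h.hp]
  have hCy : C.S.D.chart.extend (𝓡∂ (n + 1)) (L.discPoint (axisVec L C s)) =
      C.S.D.chart.extend (𝓡∂ (n + 1)) C.S.p + footModel n s C.toCtx.m C.toCtx.ρ 0 := by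
    rw [h.coord _ hmem, hy, hp, footModel_zero_eq_lowerEmb L C s]
  unfold HandleChart.foot
  rw [← hCy]
  exact (C.S.D.chart.extend (𝓡∂ (n + 1))).left_inv (by rw [C.S.D.chart.extend_source]; exact hmem)

/-- **The centres of the feet lie on the left-hand disc** `leftHandDisc g ξ q L.b`. [cite: MilnorHCobordism1965, Def. 3.9 (PDF p. 16)] -/
theorem foot_mem_leftHandDisc (h : Compat L C) {s : ℝ} (hs : s ^ 2 = 1) :
    C.S.D.foot s C.toCtx.m C.toCtx.ρ 0 ∈ leftHandDisc (𝓡∂ (n + 1)) g ξ L.q L.b := by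
  rw [foot_eq_discPoint h hs]
  have hv := norm_axisVec_le h hs
  refine mem_leftHandDisc_iff.2 ⟨L.discPoint_mem_stableSet hv, ?_⟩
  have := L.b'_le_apply_discPoint hv
  have hb := L.b_lt_b'
  exact le_of_lt (lt_of_lt_of_le hb this)

/-- A parameter of norm `≤ √m/ε_L` has norm `≤ 1` and its disc point lies in the domain of the
handle chart, with handle-chart coordinates `(ε_L v, 0)`. [folklore] -/
theorem discPoint_mem_source (h : Compat L C) {v : EuclideanSpace ℝ (Fin 1)} (hv : ‖v‖ ≤ √C.toCtx.m / L.ε) :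
    ‖v‖ ≤ 1 ∧ L.discPoint v ∈ C.S.D.chart.source ∧
      C.S.D.coord (L.discPoint v) = lowerEmb 1 (n + 1) (L.ε • v) := by
  have hv1 : ‖v‖ ≤ 1 := hv.trans (by rw [div_le_one L.eps_pos]; exact h.sqrt_m_le)
  have hw : ‖lowerEmb 1 (n + 1) (L.ε • v)‖ ≤ C.S.ε := by
    rw [L.norm_lowerEmb_smul]
    have := mul_le_mul_of_nonneg_left hv L.eps_pos.le
    rw [mul_div_cancel₀ _ L.eps_pos.ne'] at this
    exact this.trans (sqrt_m_le_ε C)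
  have hmem : L.discPoint v ∈ C.S.D.chart.source := h.chartPoint_mem _ hw
  refine ⟨hv1, hmem, ?_⟩
  have hy : L.box.chart.extend (𝓡∂ (n + 1)) (L.discPoint v) = L.box.chart.extend (𝓡∂ (n + 1)) L.q + lowerEmb 1 (n + 1) (L.ε • v) :=
    (L.box.chart.extend (𝓡∂ (n + 1))).right_inv (L.box.add_mem_target_of_norm_le (L.norm_lowerEmb_smul_lt hv1).le)
  have hp : C.S.D.chart.extend (𝓡∂ (n + 1)) C.S.p = L.box.chart.extend (𝓡∂ (n + 1)) L.q := by
    rw [h.coord _ C.S.D.mem_source, h.hp]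
  show C.S.D.chart.extend (𝓡∂ (n + 1)) (L.discPoint v) - C.S.D.chart.extend (𝓡∂ (n + 1)) C.S.p = _
  rw [h.coord _ hmem, hy, hp, add_sub_cancel_left]

/-- **The levels of `C.S.f` on the top disc**: `C.S.f (discPoint v) = C.S.f p - ε_L² ‖v‖²` for
`‖v‖ ≤ √m/ε_L` (there `C.S.f = g + d`). [cite: MilnorHCobordism1965, Def. 3.1 (2) (PDF p. 12)] -/
theorem apply_f_discPoint (h : Compat L C) {v : EuclideanSpace ℝ (Fin 1)} (hv : ‖v‖ ≤ √C.toCtx.m / L.ε) :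
    C.S.f (L.discPoint v) = C.S.f C.S.p - L.ε ^ 2 * ‖v‖ ^ 2 := by
  obtain ⟨d, hd⟩ := h.shift
  obtain ⟨hv1, hmem, -⟩ := discPoint_mem_source h hv
  rw [hd _ hmem, hd _ C.S.D.mem_source, h.hp, L.apply_discPoint hv1]; ring

/-- `ε_L² ‖v‖² ≤ m` for `‖v‖ ≤ √m/ε_L`. [folklore] -/
theorem sq_mul_norm_sq_le (L : LeftSphereSetting c g ξ 0) (C : SlideContext n c.W) {v : EuclideanSpace ℝ (Fin 1)} (hv : ‖v‖ ≤ √C.toCtx.m / L.ε) : L.ε ^ 2 * ‖v‖ ^ 2 ≤ C.toCtx.m := by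
  have hm : 0 ≤ C.toCtx.m := by rw [C.toCtx.m_eq]; positivity
  have h1 : L.ε * ‖v‖ ≤ √C.toCtx.m := by
    have := mul_le_mul_of_nonneg_left hv L.eps_pos.le
    rwa [mul_div_cancel₀ _ L.eps_pos.ne'] at this
  have h2 : 0 ≤ L.ε * ‖v‖ := mul_nonneg L.eps_pos.le (norm_nonneg v)
  calc L.ε ^ 2 * ‖v‖ ^ 2 = (L.ε * ‖v‖) ^ 2 := by ring
    _ ≤ (√C.toCtx.m) ^ 2 := pow_le_pow_left₀ h2 h1 2
    _ = C.toCtx.m := Real.sq_sqrt hm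

/-- **The axis segment between the feet lies in the handle region**, at levels `C.S.f ∈ [a, f p]`.
[cite: MilnorHCobordism1965, proof of Thm. 3.13 (PDF p. 18)] -/
theorem discPoint_mem_N (h : Compat L C) {v : EuclideanSpace ℝ (Fin 1)} (hv : ‖v‖ ≤ √C.toCtx.m / L.ε) :
    L.discPoint v ∈ C.S.N ∧ C.S.a ≤ C.S.f (L.discPoint v) ∧ C.S.f (L.discPoint v) ≤ C.S.f C.S.p := by
  obtain ⟨hv1, hmem, hcoord⟩ := discPoint_mem_source h hv
  have hlev := apply_f_discPoint h hv
  have hmv := sq_mul_norm_sq_le L C hv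
  have hε := C.S.ε_pos; have hη := C.S.η_pos
  have hma : C.S.f C.S.p - C.toCtx.m = C.S.a := by have := C.toCtx.fp_sub_m; simpa only [SlideContext.toCtx_S] using this
  have hmeq : C.toCtx.m = C.S.ε ^ 2 / 2 := by have := C.toCtx.m_eq; simpa only [SlideContext.toCtx_S] using this
  have ha_le : C.S.a ≤ C.S.f (L.discPoint v) := by rw [hlev, ← hma]; linarith
  have hle : C.S.f (L.discPoint v) ≤ C.S.f C.S.p := by rw [hlev]; nlinarith [sq_nonneg L.ε, sq_nonneg ‖v‖]
  refine ⟨⟨hmem, ?_, ?_, ?_, ?_⟩, ha_le, hle⟩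
  · -- `|x⃗|² = ε_L² ‖v‖² ≤ m < ε²`
    rw [C.hk, hcoord, sqSumLT_of_contracting (milnorModelField_lowerEmb _), L.norm_lowerEmb_smul]
    nlinarith [sq_nonneg ‖v‖]
  · rw [C.hk, hcoord, sqSumGE_of_contracting (milnorModelField_lowerEmb _)]; positivity
  · rw [C.hk, hcoord, sqSumGE_of_contracting (milnorModelField_lowerEmb _), mul_zero]; exact C.S.γ_pos.le
  · refine ⟨by linarith, ?_⟩
    have : C.S.f C.S.p ≤ C.S.ℓu := by rw [C.hℓu_eq]; nlinarith
    linarith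

/-- **A point of the left-hand disc at `g`-level `≥ g q - m` is a point of the axis segment
between the feet**: `x = discPoint v` with `‖v‖ ≤ √m/ε_L`. [cite: MilnorHCobordism1965, Def. 3.9 (PDF p. 16)] -/
theorem exists_discPoint_eq_of_le (h : Compat L C) {x : c.W} (hx : x ∈ leftHandDisc (𝓡∂ (n + 1)) g ξ L.q L.b)
    (hxm : g L.q - C.toCtx.m ≤ g x) :
    ∃ v : EuclideanSpace ℝ (Fin 1), ‖v‖ ≤ √C.toCtx.m / L.ε ∧ L.discPoint v = x := by
  have hm : 0 ≤ C.toCtx.m := by rw [C.toCtx.m_eq]; positivity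
  have hb' : L.b' ≤ g x := by
    show g L.q - L.ε ^ 2 ≤ g x
    linarith [h.m_le]
  obtain ⟨v, hv1, rfl⟩ := L.exists_discPoint_eq_of_mem_stableSet (mem_leftHandDisc_iff.1 hx).1 hb'
  refine ⟨v, ?_, rfl⟩
  rw [L.apply_discPoint hv1] at hxm
  have h1 : L.ε ^ 2 * ‖v‖ ^ 2 ≤ C.toCtx.m := by linarith
  have h2 : (L.ε * ‖v‖) ^ 2 ≤ (√C.toCtx.m) ^ 2 := by rw [mul_pow, Real.sq_sqrt hm]; exact h1
  have h3 : L.ε * ‖v‖ ≤ √C.toCtx.m := by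
    nlinarith [Real.sqrt_nonneg C.toCtx.m, mul_nonneg L.eps_pos.le (norm_nonneg v)]
  rw [le_div_iff₀ L.eps_pos]; linarith [mul_comm L.ε ‖v‖]

/-- **The `g`-level of the feet is `g q - m`.** [cite: MilnorHCobordism1965, Def. 3.1 (2) (PDF p. 12)] -/
theorem apply_g_foot (h : Compat L C) {s : ℝ} (hs : s ^ 2 = 1) : g (C.S.D.foot s C.toCtx.m C.toCtx.ρ 0) = g L.q - C.toCtx.m := by
  rw [foot_eq_discPoint h hs, L.apply_discPoint (norm_axisVec_le h hs), norm_axisVec L C hs, div_pow,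
    Real.sq_sqrt (by rw [C.toCtx.m_eq]; positivity), mul_div_cancel₀ _ (pow_ne_zero 2 L.eps_pos.ne')]

/-- The two feet are distinct. [folklore] -/
theorem foot_one_ne_foot_neg_one : C.S.D.foot 1 C.toCtx.m C.toCtx.ρ 0 ≠ C.S.D.foot (-1) C.toCtx.m C.toCtx.ρ 0 := by
  intro heq
  have hd := C.S.D.disjoint_range_foot (s := 1) (one_pow 2) C.toCtx.T.hm C.toCtx.ρ_pos C.toCtx.T.hR C.toCtx.hmR C.toCtx.T.hball
  exact Set.disjoint_iff.1 hd ⟨⟨0, rfl⟩, ⟨0, heq.symm⟩⟩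

end Compat

end Cobordism.LeftSphereSetting


end Literature.Topology.FourManifolds
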